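import Literature.Geometry.Riemannian.ShrinkerEntropyAllScalesFlow
import Literature.Geometry.Riemannian.LinearHeatCauchyExistence
import Literature.Geometry.Riemannian.BakryEmerySpectralGap
import Literature.Geometry.Riemannian.WeightedHeatFlowAPriori
import Literature.Geometry.Lorentzian.MassCapacityHarmonic
import Literature.Geometry.Lorentzian.BlackHoles
import Literature.Analysis.FluidPDE.WeightedParametricIntegral
import HarnessLib

/-!
# Cut-off calculus for the weighted heat equation on a complete (non-compact) weighted manifold

Topic `Geometry/Riemannian`. First-order bookkeeping for the energy method with compactly supported
cut-offs `η_k` for (sub)solutions of `∂ₛρ = Lρ`, `L = Δ_g − g⁻¹(dV, d·)`, on a Riemannian manifold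
`(M, g)` modelled on `ℝⁿ` (Hausdorff, second countable, `T₃` — NOT compact) with a smooth weight `V` and
the weighted measure `e^{-V} dV_g`. This is the Literature home of the generic part of the Summits-side
files `EntropyRungNoncompactShrinkerGapHeat{CutoffToolkit,MaxPrincipleAux}.lean` (route
SmoothPoincare4/EntropyRung, crux `NoncompactShrinkerGap`), which Literature may not import
(CONVENTIONS §2); the statements are re-homed here in curried form and the Summits helpers are their
specialisations. Consumers: `LinearHeatClassicalNoncompact.lean` (energy uniqueness),
`WeightedHeatFlowNoncompact.lean` (maximum principle, mass conservation, energy estimate, gradient decay),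
`ShrinkerEntropyAllScalesHolds.lean` (Li–Wang 2020, Thm. 1.1).

* `hasDerivAt_integral_mul_of_hasCompactSupport`, `continuousOn_integral_mul_of_hasCompactSupport` —
  `d/ds ∫ F(s,x) h(x) dμ = ∫ ∂ₛF(s,x) h(x) dμ` and continuity of `s ↦ ∫ F(s,x) h(x) dμ` for a compactly
  supported continuous weight `h` (`WeightedParametricIntegral.lean`);
* `integral_strip_eq_intervalIntegral`, `aestronglyMeasurable_strip`,
  `integrable_strip_mul_of_hasCompactSupport` — Fubini on the strip `X × (a,b)` for `(μ ⊗ ds)|_{X×(a,b)}`;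
* `sigmaFinite_riemVolume`, `isOpenPosMeasure_riemVolume`;
* `weightedLaplacian_affine` (`L(au + b) = aLu`), `weightedLaplacian_eq_zero_of_eventuallyEq_one`,
  `continuous_hasCompactSupport_weightedLaplacian`;
* `integral_mul_weightedLaplacian_of_hasCompactSupport` — the weighted Green identity
  `∫ a (Lb) e^{-V} = −∫ g⁻¹(da, db) e^{-V}` with `a` OR `b` compactly supported (the two cases are
  `integral_cutoff_mul_weightedLaplacian` / `integral_mul_weightedLaplacian_cutoff` of
  `ShrinkerEntropyAllScalesFlow.lean`);
* `integral_cutoff_mul_weightedLaplacian_comm` (`∫ η (Lu) e^{-V} = ∫ u (Lη) e^{-V}`) and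
  `integral_sub_mul_cutoff_mul_weightedLaplacian` — the ENERGY IDENTITY with a cut-off
  `∫ (u − c) η (Lu) e^{-V} = −∫ η |∇u|² e^{-V} + ½ ∫ (u − c)² (Lη) e^{-V}`;
* `tendsto_of_cutoff_eventually_eq_one`, `weightedLaplacian_cutoff_eventually_eq_zero`,
  `dalembertian_cutoff_eventually_eq_zero` — cut-offs eventually `= 1` near every point;
* `continuousOn_deriv_time_of_contMDiffOn`, `hasDerivAt_time_of_contMDiffOn` — time derivatives of
  functions smooth on `M × O`, `O` open;
* `integral_test_dissipation_le` — the dissipation inequality of the energy method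
  `∫ η Φ'(w)(Lw) e^{-V} ≤ ∫ |Lη| Φ(w) e^{-V}` for a convex test function `Φ ≥ 0`.

Everything is proved; no definitions, no named facts.

## References

* A. Grigor'yan, *Heat kernel and analysis on manifolds*, AMS/IP 2009, §3.6, §11.4, §12.1 (weighted
  manifolds; energy estimates with cut-off functions; uniqueness class for the Cauchy problem).
  [Grigoryan2009]
* D. Bakry, I. Gentil, M. Ledoux, *Analysis and Geometry of Markov Diffusion Operators*, Springer 2014,
  §3.2 (`∫ f Lg dμ = −∫ Γ(f,g) dμ`). [BakryGentilLedoux2014]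
* J. A. Carrillo, L. Ni, Comm. Anal. Geom. 17 (2009), §4 (integrations by parts with cut-offs on the
  complete soliton). [CarrilloNi2009]
-/

noncomputable section

open scoped Manifold ContDiff ENNReal NNReal Topology
open MeasureTheory Set Filter

namespace Literature.Geometry.Riemannian

open Lorentzian Lorentzian.PseudoRiemannianMetric

/-! ### Parametric integrals against a compactly supported weight; the strip `X × (a, b)` -/

section Measure

variable {X : Type*} [TopologicalSpace X] [MeasurableSpace X]

/-- **Leibniz rule against a compactly supported weight**: for `h` continuous with compact support,
`F, ∂ₛF` jointly continuous on `X × O` (`O` open), `d/ds ∫ F(s,x) h(x) dμ = ∫ ∂ₛF(s,x) h(x) dμ` at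
every `s₀ ∈ O` (`WeightedParametricIntegral.hasDerivAt_integral_smul_of_continuousOn`). [folklore] -/
theorem hasDerivAt_integral_mul_of_hasCompactSupport [OpensMeasurableSpace X]
    [SecondCountableTopology X] (μ : Measure X) [IsFiniteMeasureOnCompacts μ]
    {h : X → ℝ} (hh : Continuous h) (hhs : HasCompactSupport h) {F F' : ℝ → X → ℝ} {O : Set ℝ}
    (hO : IsOpen O) (hF : ContinuousOn (fun p : X × ℝ ↦ F p.2 p.1) (univ ×ˢ O))
    (hF' : ContinuousOn (fun p : X × ℝ ↦ F' p.2 p.1) (univ ×ˢ O))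
    (hd : ∀ s ∈ O, ∀ x, HasDerivAt (F · x) (F' s x) s) {s₀ : ℝ} (hs₀ : s₀ ∈ O) :
    HasDerivAt (fun s ↦ ∫ x, F s x * h x ∂μ) (∫ x, F' s₀ x * h x ∂μ) s₀ := by
  have hsw : ∀ {G : ℝ → X → ℝ}, ContinuousOn (fun p : X × ℝ ↦ G p.2 p.1) (univ ×ˢ O) →
      ContinuousOn (Function.uncurry G) (O ×ˢ univ) := fun {G} hG ↦ by
    have h1 : ContinuousOn (fun q : ℝ × X ↦ (q.2, q.1)) (O ×ˢ univ) :=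
      (continuous_snd.prodMk continuous_fst).continuousOn
    refine (hG.comp h1 fun q hq ↦ ⟨mem_univ _, hq.1⟩).congr fun q _ ↦ ?_
    simp [Function.uncurry]
  have hmain := Literature.Analysis.FluidPDE.hasDerivAt_integral_smul_of_continuousOn (μ := μ) hh
    hhs hO (hsw hF) (hsw hF') hd hs₀
  have e1 : (fun s ↦ ∫ x, F s x * h x ∂μ) = fun s ↦ ∫ x, h x • F s x ∂μ := by
    funext s; congr 1; funext x; rw [smul_eq_mul, mul_comm]
  have e2 : ∫ x, F' s₀ x * h x ∂μ = ∫ x, h x • F' s₀ x ∂μ := by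
    congr 1; funext x; rw [smul_eq_mul, mul_comm]
  rw [e1, e2]
  exact hmain

/-- **Continuity of `s ↦ ∫ F(s,x) h(x) dμ` on `O`** for `h` continuous with compact support and
`F` jointly continuous on `X × O`. [folklore] -/
theorem continuousOn_integral_mul_of_hasCompactSupport [OpensMeasurableSpace X]
    (μ : Measure X) [IsFiniteMeasureOnCompacts μ]
    {h : X → ℝ} (hh : Continuous h) (hhs : HasCompactSupport h) {F : ℝ → X → ℝ} {O : Set ℝ}
    (hF : ContinuousOn (fun p : X × ℝ ↦ F p.2 p.1) (univ ×ˢ O)) :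
    ContinuousOn (fun s ↦ ∫ x, F s x * h x ∂μ) O := by
  have h1 : ContinuousOn (fun q : ℝ × X ↦ (q.2, q.1)) (O ×ˢ univ) :=
    (continuous_snd.prodMk continuous_fst).continuousOn
  have hsw : ContinuousOn (Function.uncurry F) (O ×ˢ univ) :=
    (hF.comp h1 fun q hq ↦ ⟨mem_univ _, hq.1⟩).congr fun q _ ↦ by simp [Function.uncurry]
  have hmain := Literature.Analysis.FluidPDE.continuousOn_integral_smul_of_continuousOn (μ := μ)
    hh hhs hsw
  have e1 : (fun s ↦ ∫ x, F s x * h x ∂μ) = fun s ↦ ∫ x, h x • F s x ∂μ := by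
    funext s; congr 1; funext x; rw [smul_eq_mul, mul_comm]
  rw [e1]
  exact hmain

omit [TopologicalSpace X] in
/-- **Fubini on the strip**: for `f` integrable on `X × (a, b)` (`μ ⊗ ds` restricted),
`∫∫_{X×(a,b)} f = ∫ₐᵇ (∫_X f(x, s) dμ) ds`. [folklore] -/
theorem integral_strip_eq_intervalIntegral (μ : Measure X) [SFinite μ] {a b : ℝ} (hab : a ≤ b)
    {f : X × ℝ → ℝ}
    (hf : Integrable f ((μ.prod (volume : Measure ℝ)).restrict (univ ×ˢ Ioo a b))) :
    ∫ p, f p ∂(μ.prod (volume : Measure ℝ)).restrict (univ ×ˢ Ioo a b) =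
      ∫ s in a..b, ∫ x, f (x, s) ∂μ := by
  have hν : (μ.prod (volume : Measure ℝ)).restrict (univ ×ˢ Ioo a b) =
      μ.prod ((volume : Measure ℝ).restrict (Ioo a b)) := by
    rw [← Measure.prod_restrict, Measure.restrict_univ]
  rw [hν] at hf ⊢
  rw [integral_prod_symm f hf, intervalIntegral.integral_of_le hab, integral_Ioc_eq_integral_Ioo]

/-- A function continuous on the strip `X × (a, b)` is a.e. strongly measurable for
`(μ ⊗ ds)|_{X × (a,b)}`. [folklore] -/
theorem aestronglyMeasurable_strip [OpensMeasurableSpace X] [SecondCountableTopology X]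
    (μ : Measure X) {a b : ℝ} {f : X × ℝ → ℝ} (hf : ContinuousOn f (univ ×ˢ Ioo a b)) :
    AEStronglyMeasurable f ((μ.prod (volume : Measure ℝ)).restrict (univ ×ˢ Ioo a b)) :=
  hf.aestronglyMeasurable (MeasurableSet.univ.prod measurableSet_Ioo)

/-- **Integrability on the strip of `F(x,s) h(x)`** for `F` continuous on `X × [a, b]` and `h`
continuous with compact support (bounded on the compact `tsupport h × [a, b]`, zero elsewhere).
[folklore] -/
theorem integrable_strip_mul_of_hasCompactSupport [OpensMeasurableSpace X]
    [SecondCountableTopology X] (μ : Measure X) [IsFiniteMeasureOnCompacts μ] [SFinite μ]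
    {a b : ℝ} {F : X × ℝ → ℝ} (hF : ContinuousOn F (univ ×ˢ Icc a b)) {h : X → ℝ}
    (hh : Continuous h) (hhs : HasCompactSupport h) :
    Integrable (fun p : X × ℝ ↦ F p * h p.1)
      ((μ.prod (volume : Measure ℝ)).restrict (univ ×ˢ Ioo a b)) := by
  have hK : IsCompact (tsupport h ×ˢ Icc a b) := hhs.prod isCompact_Icc
  have hc : ContinuousOn (fun p : X × ℝ ↦ F p * h p.1) (tsupport h ×ˢ Icc a b) :=
    (hF.mono (prod_mono (subset_univ _) le_rfl)).mul (hh.comp continuous_fst).continuousOn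
  have h1 : IntegrableOn (fun p : X × ℝ ↦ F p * h p.1) (tsupport h ×ˢ Icc a b)
      (μ.prod (volume : Measure ℝ)) :=
    hc.integrableOn_compact' hK ((isClosed_tsupport h).prod isClosed_Icc).measurableSet
  refine h1.of_forall_sdiff_eq_zero (MeasurableSet.univ.prod measurableSet_Ioo) fun p hp ↦ ?_
  have hp1 : p.1 ∉ tsupport h := fun h' ↦ hp.2 ⟨h', Ioo_subset_Icc_self hp.1.2⟩
  simp [image_eq_zero_of_notMem_tsupport hp1]

end Measure

/-! ### The Riemannian measure of a second countable manifold; Green identities with compact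
support on `g.riemVolume` -/

section Manifold

variable {n : ℕ} {M : Type*} [TopologicalSpace M] [T2Space M] [SecondCountableTopology M]
  [ChartedSpace (EuclideanSpace ℝ (Fin n)) M] [IsManifold (𝓡 n) ∞ M] [T3Space M]
  [MeasurableSpace M] [BorelSpace M]
  {g : PseudoRiemannianMetric (𝓡 n) ∞ (EuclideanSpace ℝ (Fin n)) (TangentSpace (𝓡 n) : M → Type _)}

omit [T2Space M] in
/-- The Riemannian measure of a Riemannian metric on a second countable manifold modelled on `ℝⁿ`
is σ-finite (finite on compact sets, locally compact, second countable). [folklore] -/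
theorem sigmaFinite_riemVolume (hg : g.IsRiemannian) : SigmaFinite g.riemVolume := by
  haveI : LocallyCompactSpace M := ChartedSpace.locallyCompactSpace (EuclideanSpace ℝ (Fin n)) M
  haveI := CarrilloNi2009_shrinkerLSI.isFiniteMeasureOnCompacts_riemVolume hg
  infer_instance

omit [T2Space M] [SecondCountableTopology M] in
/-- The Riemannian measure charges nonempty open sets. [folklore] -/
theorem isOpenPosMeasure_riemVolume (hg : g.IsRiemannian) : g.riemVolume.IsOpenPosMeasure := by
  rw [PseudoRiemannianMetric.riemVolume_eq hg]
  exact isOpenPosMeasure_riemannianMeasure _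

variable [g.HasLeviCivita]

/-! ### Two integrations by parts against a compactly supported cut-off -/

/-- **`∫ η (Lu) e^{-V} = ∫ u (Lη) e^{-V}`** for `u, V` smooth and `η` smooth with compact support
(both sides are `−∫ g⁻¹(dη, du) e^{-V}`). [cite: BakryGentilLedoux2014, §3.2] -/
theorem integral_cutoff_mul_weightedLaplacian_comm (hg : g.IsRiemannian) {u η V : M → ℝ}
    (hu : ContMDiff (𝓡 n) 𝓘(ℝ, ℝ) ∞ u) (hη : ContMDiff (𝓡 n) 𝓘(ℝ, ℝ) ∞ η)
    (hηc : HasCompactSupport η) (hV : ContMDiff (𝓡 n) 𝓘(ℝ, ℝ) ∞ V) :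
    ∫ x, η x * (g.dalembertian u x - g.innerDual x (mvfderiv (𝓡 n) V x).toLinearMap
        (mvfderiv (𝓡 n) u x).toLinearMap) * Real.exp (-V x) ∂g.riemVolume =
      ∫ x, u x * (g.dalembertian η x - g.innerDual x (mvfderiv (𝓡 n) V x).toLinearMap
        (mvfderiv (𝓡 n) η x).toLinearMap) * Real.exp (-V x) ∂g.riemVolume := by
  have h2 : (2 : ℕ∞ω) ≤ (∞ : ℕ∞ω) := WithTop.coe_le_coe.mpr le_top
  have h1 : (1 : ℕ∞ω) ≤ (∞ : ℕ∞ω) := WithTop.coe_le_coe.mpr le_top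
  exact integral_cutoff_mul_weightedLaplacian_symm hg (hη.of_le h2) hηc (hu.of_le h2) (hV.of_le h1)

/-- **The energy identity with a cut-off**: for `u, V` smooth, `η` smooth with compact support
and a constant `c`,
`∫ (u − c) η (Lu) e^{-V} = −∫ η |∇u|² e^{-V} + ½ ∫ (u − c)² (Lη) e^{-V}`:
Green with the compactly supported `(u − c)η` gives `−∫ (η|du|² + (u − c) g⁻¹(dη, du)) e^{-V}`,
and `2 (u − c) g⁻¹(dη, du) = g⁻¹(dη, d(u − c)²)` is moved onto `Lη` by Green with the compactly
supported `η`. Only `Lη` — no separate second derivative of `η` — appears.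
[cite: CarrilloNi2009, §4 (integration by parts on the complete soliton)] -/
theorem integral_sub_mul_cutoff_mul_weightedLaplacian (hg : g.IsRiemannian) {u η V : M → ℝ}
    (hu : ContMDiff (𝓡 n) 𝓘(ℝ, ℝ) ∞ u) (hη : ContMDiff (𝓡 n) 𝓘(ℝ, ℝ) ∞ η)
    (hηc : HasCompactSupport η) (hV : ContMDiff (𝓡 n) 𝓘(ℝ, ℝ) ∞ V) (c : ℝ) :
    ∫ x, (u x - c) * η x * (g.dalembertian u x - g.innerDual x (mvfderiv (𝓡 n) V x).toLinearMap
        (mvfderiv (𝓡 n) u x).toLinearMap) * Real.exp (-V x) ∂g.riemVolume =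
      -∫ x, η x * g.gradSq u x * Real.exp (-V x) ∂g.riemVolume
        + 1 / 2 * ∫ x, (u x - c) ^ 2 * (g.dalembertian η x
          - g.innerDual x (mvfderiv (𝓡 n) V x).toLinearMap (mvfderiv (𝓡 n) η x).toLinearMap) *
            Real.exp (-V x) ∂g.riemVolume := by
  haveI := CarrilloNi2009_shrinkerLSI.isFiniteMeasureOnCompacts_riemVolume hg
  have h2 : (2 : ℕ∞ω) ≤ (∞ : ℕ∞ω) := WithTop.coe_le_coe.mpr le_top
  have h1 : (1 : ℕ∞ω) ≤ (∞ : ℕ∞ω) := WithTop.coe_le_coe.mpr le_top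
  -- smoothness and differentiability
  have hsub : ContMDiff (𝓡 n) 𝓘(ℝ, ℝ) ∞ (fun y ↦ u y - c) := hu.sub contMDiff_const
  have ha : ContMDiff (𝓡 n) 𝓘(ℝ, ℝ) ∞ (fun y ↦ (u y - c) * η y) := hsub.mul hη
  have hac : HasCompactSupport (fun y ↦ (u y - c) * η y) := hηc.mul_left
  have hsq : ContMDiff (𝓡 n) 𝓘(ℝ, ℝ) ∞ (fun y ↦ (u y - c) ^ 2) :=
    ((contDiff_id (𝕜 := ℝ)).pow 2).comp_contMDiff hsub
  have hud : ∀ x, MDifferentiableAt (𝓡 n) 𝓘(ℝ, ℝ) u x := fun x ↦ hu.mdifferentiableAt (by simp)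
  have hηd : ∀ x, MDifferentiableAt (𝓡 n) 𝓘(ℝ, ℝ) η x := fun x ↦ hη.mdifferentiableAt (by simp)
  have hsubd : ∀ x, MDifferentiableAt (𝓡 n) 𝓘(ℝ, ℝ) (fun y ↦ u y - c) x := fun x ↦
    hsub.mdifferentiableAt (by simp)
  have hdsub : ∀ x, mvfderiv (𝓡 n) (fun y ↦ u y - c) x = mvfderiv (𝓡 n) u x := fun x ↦ by
    rw [mvfderiv_fun_sub (hud x) mdifferentiableAt_const, mvfderiv_const, sub_zero]
  -- `d((u - c) η) = (u - c) dη + η du`, `d(u - c)² = 2 (u - c) du`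
  have hda : ∀ x, (mvfderiv (𝓡 n) (fun y ↦ (u y - c) * η y) x).toLinearMap =
      (u x - c) • (mvfderiv (𝓡 n) η x).toLinearMap + η x • (mvfderiv (𝓡 n) u x).toLinearMap := by
    intro x
    rw [mvfderiv_fun_mul (hsubd x) (hηd x), hdsub x]
    simp
  have hdsq : ∀ x, (mvfderiv (𝓡 n) (fun y ↦ (u y - c) ^ 2) x).toLinearMap =
      (2 * (u x - c)) • (mvfderiv (𝓡 n) u x).toLinearMap := by
    intro x
    ext v
    have hd1 : HasDerivAt (fun t : ℝ ↦ t ^ 2) (2 * (u x - c)) (u x - c) := by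
      simpa using hasDerivAt_pow 2 (u x - c)
    have hc := mvfderiv_real_comp_apply (I := 𝓡 n) (φ := fun y ↦ u y - c) (x := x) hd1
      (hsubd x) v
    rw [hdsub x] at hc
    simpa [Function.comp_def] using hc
  -- the two Green identities
  have hA : ∫ x, (u x - c) * η x * (g.dalembertian u x
        - g.innerDual x (mvfderiv (𝓡 n) V x).toLinearMap (mvfderiv (𝓡 n) u x).toLinearMap) *
          Real.exp (-V x) ∂g.riemVolume =
      -∫ x, g.innerDual x (mvfderiv (𝓡 n) (fun y ↦ (u y - c) * η y) x).toLinearMap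
          (mvfderiv (𝓡 n) u x).toLinearMap * Real.exp (-V x) ∂g.riemVolume :=
    integral_cutoff_mul_weightedLaplacian hg (ha.of_le h1) hac (hu.of_le h2)
      (hV.of_le h1)
  have hB : ∫ x, (u x - c) ^ 2 * (g.dalembertian η x
        - g.innerDual x (mvfderiv (𝓡 n) V x).toLinearMap (mvfderiv (𝓡 n) η x).toLinearMap) *
          Real.exp (-V x) ∂g.riemVolume =
      -∫ x, g.innerDual x (mvfderiv (𝓡 n) (fun y ↦ (u y - c) ^ 2) x).toLinearMap
          (mvfderiv (𝓡 n) η x).toLinearMap * Real.exp (-V x) ∂g.riemVolume :=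
    integral_mul_weightedLaplacian_cutoff hg (hsq.of_le h1) (hη.of_le h2) hηc
      (hV.of_le h1)
  -- pointwise forms of the right-hand sides
  have hpA : ∀ x, g.innerDual x (mvfderiv (𝓡 n) (fun y ↦ (u y - c) * η y) x).toLinearMap
        (mvfderiv (𝓡 n) u x).toLinearMap * Real.exp (-V x) =
      η x * g.gradSq u x * Real.exp (-V x) + (u x - c) * g.innerDual x
        (mvfderiv (𝓡 n) η x).toLinearMap (mvfderiv (𝓡 n) u x).toLinearMap * Real.exp (-V x) := by
    intro x
    rw [hda x, g.innerDual_add_left, g.innerDual_smul_left, g.innerDual_smul_left]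
    simp only [PseudoRiemannianMetric.gradSq]
    ring
  have hpB : ∀ x, g.innerDual x (mvfderiv (𝓡 n) (fun y ↦ (u y - c) ^ 2) x).toLinearMap
        (mvfderiv (𝓡 n) η x).toLinearMap * Real.exp (-V x) =
      2 * ((u x - c) * g.innerDual x (mvfderiv (𝓡 n) η x).toLinearMap
        (mvfderiv (𝓡 n) u x).toLinearMap * Real.exp (-V x)) := by
    intro x
    rw [hdsq x, g.innerDual_smul_left, g.innerDual_comm]
    ring
  -- integrability of the two pieces (compact support)
  have hec : Continuous fun x ↦ Real.exp (-V x) := Real.continuous_exp.comp hV.continuous.neg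
  have hIc := continuous_innerDual_mvfderiv g (hη.of_le h1) (hu.of_le h1)
  have iG : Integrable (fun x ↦ η x * g.gradSq u x * Real.exp (-V x)) g.riemVolume :=
    ((hη.continuous.mul (contMDiff_gradSq g hu).continuous).mul hec).integrable_of_hasCompactSupport
      (hηc.mul_right.mul_right)
  have iX : Integrable (fun x ↦ (u x - c) * g.innerDual x (mvfderiv (𝓡 n) η x).toLinearMap
      (mvfderiv (𝓡 n) u x).toLinearMap * Real.exp (-V x)) g.riemVolume := by
    have hs : HasCompactSupport (fun x ↦ (u x - c) * g.innerDual x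
        (mvfderiv (𝓡 n) η x).toLinearMap (mvfderiv (𝓡 n) u x).toLinearMap * Real.exp (-V x)) := by
      refine HasCompactSupport.intro hηc fun x hx ↦ ?_
      rw [innerDual_mvfderiv_eq_zero_of_notMem_tsupport hx, mul_zero, zero_mul]
    exact ((hsub.continuous.mul hIc).mul hec).integrable_of_hasCompactSupport hs
  rw [hA, hB, integral_congr_ae (Eventually.of_forall hpA), integral_add iG iX,
    integral_congr_ae (Eventually.of_forall hpB), integral_const_mul]
  ring

/-! ### Vocabulary: cut-off exhaustions and classical solutions of the weighted heat equation -/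

/-- **A cut-off exhaustion** of the manifold: a sequence `η_k ∈ C_c^∞(M)` with `0 ≤ η_k ≤ η_{k+1} ≤ 1`
which is eventually `= 1` near every point. (The first five of the standing hypotheses on the cut-offs of
the energy method on a complete manifold; the sixth — a uniform bound on `Δη_k` or on `Lη_k` — is added
by `IsLaplacianCutoff` / `IsWeightedCutoff`.) [cite: Grigoryan2009, §11.4 (cut-off functions of an
exhaustion by compact sets); CarrilloNi2009, §4] -/
structure IsCutoffExhaustion
    (g : PseudoRiemannianMetric (𝓡 n) ∞ (EuclideanSpace ℝ (Fin n)) (TangentSpace (𝓡 n) : M → Type _))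
    (η : ℕ → M → ℝ) : Prop where
  contMDiff : ∀ k, ContMDiff (𝓡 n) 𝓘(ℝ, ℝ) ∞ (η k)
  hasCompactSupport : ∀ k, HasCompactSupport (η k)
  nonneg_le_one : ∀ k x, 0 ≤ η k x ∧ η k x ≤ 1
  le_succ : ∀ k x, η k x ≤ η (k + 1) x
  eventually_eq_one : ∀ x, ∀ᶠ k in atTop, ∀ᶠ y in 𝓝 x, η k y = 1

/-- **Laplacian cut-offs**: a cut-off exhaustion with `|Δ_g η_k| ≤ C` uniformly in `k` (the cut-offs of
the energy method for the UNWEIGHTED equation `∂ₛw = Δw − Qw`). On a complete gradient shrinker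
`η_k = ψ(f/(k+1))` qualifies (`ShrinkerEntropyAllScalesHolds.lean`). [cite: Grigoryan2009, §11.4;
CarrilloNi2009, §4] -/
structure IsLaplacianCutoff
    (g : PseudoRiemannianMetric (𝓡 n) ∞ (EuclideanSpace ℝ (Fin n)) (TangentSpace (𝓡 n) : M → Type _)) [g.HasLeviCivita]
    (η : ℕ → M → ℝ) (C : ℝ) : Prop extends IsCutoffExhaustion g η where
  abs_dalembertian_le : ∀ k x, |g.dalembertian (η k) x| ≤ C

/-- **Weighted cut-offs**: a cut-off exhaustion with `|Lη_k| ≤ C` uniformly in `k`,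
`L = Δ_g − g⁻¹(dV, d·)` (the cut-offs of the energy method for the weighted equation `∂ₛρ = Lρ`).
[cite: Grigoryan2009, §11.4; CarrilloNi2009, §4] -/
structure IsWeightedCutoff
    (g : PseudoRiemannianMetric (𝓡 n) ∞ (EuclideanSpace ℝ (Fin n)) (TangentSpace (𝓡 n) : M → Type _)) [g.HasLeviCivita]
    (V : M → ℝ) (η : ℕ → M → ℝ) (C : ℝ) : Prop extends IsCutoffExhaustion g η where
  abs_weightedLaplacian_le : ∀ k x, |g.dalembertian (η k) x
    - g.innerDual x (mvfderiv (𝓡 n) V x).toLinearMap (mvfderiv (𝓡 n) (η k) x).toLinearMap| ≤ C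

/-- **A classical solution of the weighted heat equation `∂ₛρ = Lρ` on `[0, T]`**,
`L = Δ_g − g⁻¹(dV, d·)`, smooth on `M × O` for an open set of times `O ⊇ [0, T]` (so that the time
derivative in the equation is the two-sided `deriv`, also at `s = 0` and `s = T`). This is the shape in
which the Cauchy problem is solved below (`WeightedHeatFlowNoncompact.lean`) and consumed by the a-priori
estimates. [cite: Grigoryan2009, §8 (the Cauchy problem on a weighted manifold)] -/
structure IsWeightedHeatSolOn
    (g : PseudoRiemannianMetric (𝓡 n) ∞ (EuclideanSpace ℝ (Fin n)) (TangentSpace (𝓡 n) : M → Type _)) [g.HasLeviCivita]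
    (V : M → ℝ) (ρ : ℝ → M → ℝ) (O : Set ℝ) (T : ℝ) : Prop where
  isOpen : IsOpen O
  Icc_subset : Icc 0 T ⊆ O
  contMDiffOn : ContMDiffOn ((𝓡 n).prod 𝓘(ℝ, ℝ)) 𝓘(ℝ, ℝ) ∞ (fun p : M × ℝ ↦ ρ p.2 p.1) (univ ×ˢ O)
  deriv_eq : ∀ s ∈ Icc 0 T, ∀ x, deriv (fun r ↦ ρ r x) s = g.dalembertian (ρ s) x
    - g.innerDual x (mvfderiv (𝓡 n) V x).toLinearMap (mvfderiv (𝓡 n) (ρ s) x).toLinearMap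

/-! ### Cut-offs eventually equal to one near every point -/

namespace IsCutoffExhaustion

omit [T2Space M] [SecondCountableTopology M] [T3Space M] [MeasurableSpace M] [BorelSpace M]
  [g.HasLeviCivita] in
/-- A cut-off exhaustion converges to `1` pointwise. [folklore] -/
theorem tendsto_one {η : ℕ → M → ℝ} (hη : IsCutoffExhaustion g η) (x : M) :
    Tendsto (fun k ↦ η k x) atTop (𝓝 1) :=
  tendsto_const_nhds.congr' (by
    filter_upwards [hη.eventually_eq_one x] with k hk
    exact (hk.self_of_nhds).symm)

omit [T2Space M] [SecondCountableTopology M] [T3Space M] [MeasurableSpace M] [BorelSpace M]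
  [g.HasLeviCivita] in
/-- A cut-off exhaustion is pointwise monotone in `k`. [folklore] -/
theorem monotone {η : ℕ → M → ℝ} (hη : IsCutoffExhaustion g η) (x : M) : Monotone fun k ↦ η k x :=
  monotone_nat_of_le_succ fun k ↦ hη.le_succ k x

omit [T2Space M] [SecondCountableTopology M] [T3Space M] [MeasurableSpace M] [BorelSpace M] in
/-- For a cut-off exhaustion, `Lη_k(x) = Δη_k(x) − g⁻¹(dV, dη_k)(x) = 0` for all large `k` (locality of
`Δ_g` and of `d`). [folklore] -/
theorem weightedLaplacian_eventually_eq_zero {η : ℕ → M → ℝ} (hη : IsCutoffExhaustion g η)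
    (V : M → ℝ) (x : M) :
    ∀ᶠ k in atTop, g.dalembertian (η k) x - g.innerDual x (mvfderiv (𝓡 n) V x).toLinearMap
      (mvfderiv (𝓡 n) (η k) x).toLinearMap = 0 := by
  haveI : Fact ((1 : ℕ∞ω) ≤ (∞ : ℕ∞ω)) := ⟨WithTop.coe_le_coe.2 le_top⟩
  filter_upwards [hη.eventually_eq_one x] with k hk
  have hk' : η k =ᶠ[𝓝 x] fun _ ↦ (1 : ℝ) := hk
  rw [g.dalembertian_congr_of_eventuallyEq hk', g.dalembertian_const, mvfderiv_congr_of_eventuallyEq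
    hk', mvfderiv_const, ContinuousLinearMap.toLinearMap_zero, g.innerDual_comm]
  simp [PseudoRiemannianMetric.innerDual]

omit [T2Space M] [SecondCountableTopology M] [T3Space M] [MeasurableSpace M] [BorelSpace M] in
/-- For a cut-off exhaustion, `Δη_k(x) = 0` for all large `k`. [folklore] -/
theorem dalembertian_eventually_eq_zero {η : ℕ → M → ℝ} (hη : IsCutoffExhaustion g η) (x : M) :
    ∀ᶠ k in atTop, g.dalembertian (η k) x = 0 := by
  haveI : Fact ((1 : ℕ∞ω) ≤ (∞ : ℕ∞ω)) := ⟨WithTop.coe_le_coe.2 le_top⟩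
  filter_upwards [hη.eventually_eq_one x] with k hk
  have hk' : η k =ᶠ[𝓝 x] fun _ ↦ (1 : ℝ) := hk
  rw [g.dalembertian_congr_of_eventuallyEq hk', g.dalembertian_const]

omit [T2Space M] [MeasurableSpace M] [BorelSpace M] in
/-- The weighted Laplacian `Lη_k` of a member of a cut-off exhaustion is continuous with compact support.
[folklore] -/
theorem continuous_hasCompactSupport_weightedLaplacian {η : ℕ → M → ℝ} (hη : IsCutoffExhaustion g η)
    {V : M → ℝ} (hV : ContMDiff (𝓡 n) 𝓘(ℝ, ℝ) ∞ V) (k : ℕ) :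
    Continuous (fun x ↦ g.dalembertian (η k) x - g.innerDual x (mvfderiv (𝓡 n) V x).toLinearMap
      (mvfderiv (𝓡 n) (η k) x).toLinearMap) ∧
    HasCompactSupport (fun x ↦ g.dalembertian (η k) x - g.innerDual x
      (mvfderiv (𝓡 n) V x).toLinearMap (mvfderiv (𝓡 n) (η k) x).toLinearMap) := by
  refine ⟨(continuous_dalembertian g ((hη.contMDiff k).of_le (WithTop.coe_le_coe.mpr le_top))).sub
    (continuous_innerDual_mvfderiv g (hV.of_le (by norm_num)) ((hη.contMDiff k).of_le (by norm_num))),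
    HasCompactSupport.intro (hη.hasCompactSupport k) fun x hx ↦ ?_⟩
  simp [g.dalembertian_eq_zero_of_notMem_tsupport hx, mvfderiv_eq_zero_of_notMem_tsupport hx,
    PseudoRiemannianMetric.innerDual]

end IsCutoffExhaustion

namespace IsWeightedHeatSolOn

omit [T2Space M] [SecondCountableTopology M] [T3Space M] [MeasurableSpace M] [BorelSpace M] in
/-- The time slices of a classical solution are smooth. [folklore] -/
theorem contMDiff_slice {V : M → ℝ} {ρ : ℝ → M → ℝ} {O : Set ℝ} {T : ℝ}
    (hρ : IsWeightedHeatSolOn g V ρ O T) {s : ℝ} (hs : s ∈ O) : ContMDiff (𝓡 n) 𝓘(ℝ, ℝ) ∞ (ρ s) :=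
  contMDiff_slice_of_contMDiffOn hρ.contMDiffOn hs

omit [T2Space M] [SecondCountableTopology M] [T3Space M] [MeasurableSpace M] [BorelSpace M] in
/-- The time derivative of a classical solution exists (two-sided) at every time of `O`. [folklore] -/
theorem hasDerivAt {V : M → ℝ} {ρ : ℝ → M → ℝ} {O : Set ℝ} {T : ℝ}
    (hρ : IsWeightedHeatSolOn g V ρ O T) (x : M) {s : ℝ} (hs : s ∈ O) :
    HasDerivAt (fun r ↦ ρ r x) (deriv (fun r ↦ ρ r x) s) s :=
  hasDerivAt_slice_of_contMDiffOn hρ.isOpen (v := fun p : M × ℝ ↦ ρ p.2 p.1) hρ.contMDiffOn x hs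

omit [T2Space M] [SecondCountableTopology M] [T3Space M] [MeasurableSpace M] [BorelSpace M] in
/-- Restriction of a classical solution on `[0, T]` to `[0, T']`, `T' ≤ T`. [folklore] -/
theorem mono {V : M → ℝ} {ρ : ℝ → M → ℝ} {O : Set ℝ} {T T' : ℝ}
    (hρ : IsWeightedHeatSolOn g V ρ O T) (hT' : T' ≤ T) : IsWeightedHeatSolOn g V ρ O T' :=
  ⟨hρ.isOpen, (Icc_subset_Icc_right hT').trans hρ.Icc_subset, hρ.contMDiffOn,
    fun s hs x ↦ hρ.deriv_eq s (Icc_subset_Icc_right hT' hs) x⟩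

end IsWeightedHeatSolOn

/-! ### Time derivatives of functions smooth on `M × O`, `O` open -/

omit [T2Space M] [SecondCountableTopology M] [T3Space M] [MeasurableSpace M] [BorelSpace M]
  [g.HasLeviCivita] in
/-- For `ρ` smooth on `M × O` (`O` open), `(x, s) ↦ ∂ₛρ(s, x)` is continuous on `M × O`
(`contMDiffOn_derivWithin_time_of_uniqueDiffOn`, `derivWithin = deriv` on the open `O`).
[folklore] -/
theorem continuousOn_deriv_time_of_contMDiffOn {O : Set ℝ} (hO : IsOpen O) {ρ : ℝ → M → ℝ}
    (hρ : ContMDiffOn ((𝓡 n).prod 𝓘(ℝ, ℝ)) 𝓘(ℝ, ℝ) ∞ (fun p : M × ℝ ↦ ρ p.2 p.1) (univ ×ˢ O)) :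
    ContinuousOn (fun p : M × ℝ ↦ deriv (fun r ↦ ρ r p.1) p.2) (univ ×ˢ O) := by
  have h := (contMDiffOn_derivWithin_time_of_uniqueDiffOn hO.uniqueDiffOn hρ).continuousOn
  refine h.congr fun p hp ↦ ?_
  exact (derivWithin_of_isOpen hO hp.2).symm

omit [T2Space M] [SecondCountableTopology M] [IsManifold (𝓡 n) ∞ M] [T3Space M]
  [MeasurableSpace M] [BorelSpace M] [g.HasLeviCivita] in
/-- For `ρ` smooth on `M × O` (`O` open), `s ↦ ρ(s, x)` has derivative `deriv (ρ · x) s` at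
`s ∈ O`. [folklore] -/
theorem hasDerivAt_time_of_contMDiffOn {O : Set ℝ} (hO : IsOpen O) {ρ : ℝ → M → ℝ}
    (hρ : ContMDiffOn ((𝓡 n).prod 𝓘(ℝ, ℝ)) 𝓘(ℝ, ℝ) ∞ (fun p : M × ℝ ↦ ρ p.2 p.1) (univ ×ˢ O))
    (x : M) {s : ℝ} (hs : s ∈ O) :
    HasDerivAt (fun r ↦ ρ r x) (deriv (fun r ↦ ρ r x) s) s :=
  hasDerivAt_slice_of_contMDiffOn hO (v := fun p : M × ℝ ↦ ρ p.2 p.1) hρ x hs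


/-! ### Pointwise facts on the weighted Laplacian `L u = Δu − g⁻¹(dV, du)` -/

omit [T2Space M] [SecondCountableTopology M] [T3Space M] [MeasurableSpace M] [BorelSpace M] in
/-- **`L(a u + b) = a Lu`** for constants `a, b` and `u` of class `C²` at the point (chain rule for
`Δ_g` and `d` with the affine function `t ↦ a t + b`). [folklore] -/
theorem weightedLaplacian_affine {u V : M → ℝ} {x : M} (hu : ContMDiffAt (𝓡 n) 𝓘(ℝ, ℝ) 2 u x)
    (a b : ℝ) :
    g.dalembertian (fun y ↦ a * u y + b) x - g.innerDual x (mvfderiv (𝓡 n) V x).toLinearMap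
        (mvfderiv (𝓡 n) (fun y ↦ a * u y + b) x).toLinearMap =
      a * (g.dalembertian u x - g.innerDual x (mvfderiv (𝓡 n) V x).toLinearMap
        (mvfderiv (𝓡 n) u x).toLinearMap) := by
  have hζ : ContDiff ℝ 2 (fun t : ℝ ↦ a * t + b) :=
    (contDiff_const.mul contDiff_id).add contDiff_const
  have hζ1 : ∀ t, HasDerivAt (fun t : ℝ ↦ a * t + b) a t := fun t ↦ by
    simpa using ((hasDerivAt_id t).const_mul a).add_const b
  have hd1 : deriv (fun t : ℝ ↦ a * t + b) = fun _ ↦ a := funext fun t ↦ (hζ1 t).deriv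
  have hcomp : (fun y ↦ a * u y + b) = (fun t : ℝ ↦ a * t + b) ∘ u := rfl
  have hΔ : g.dalembertian (fun y ↦ a * u y + b) x = a * g.dalembertian u x := by
    rw [hcomp, g.dalembertian_real_comp hu hζ.contDiffAt, hd1]
    simp
  have hd : (mvfderiv (𝓡 n) (fun y ↦ a * u y + b) x).toLinearMap =
      a • (mvfderiv (𝓡 n) u x).toLinearMap := by
    ext v
    have h := mvfderiv_real_comp_apply (I := 𝓡 n) (hζ1 (u x)) (hu.mdifferentiableAt (by norm_num)) v
    simpa [hcomp] using h
  rw [hΔ, hd, g.innerDual_smul_right]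
  ring

omit [T2Space M] [SecondCountableTopology M] [T3Space M] [MeasurableSpace M] [BorelSpace M] in
/-- **`Lη(x) = 0` if `η = 1` near `x`** (`η` smooth): `L(η − 1) = Lη` and `η − 1` vanishes near `x`
(locality of `Δ_g` and of `d`). [folklore] -/
theorem weightedLaplacian_eq_zero_of_eventuallyEq_one {η V : M → ℝ} {x : M}
    (hη : ContMDiff (𝓡 n) 𝓘(ℝ, ℝ) ∞ η) (h : ∀ᶠ y in 𝓝 x, η y = 1) :
    g.dalembertian η x - g.innerDual x (mvfderiv (𝓡 n) V x).toLinearMap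
      (mvfderiv (𝓡 n) η x).toLinearMap = 0 := by
  have h0 : (fun y ↦ (1 : ℝ) * η y + (-1)) =ᶠ[𝓝 x] fun _ ↦ 0 := h.mono fun y hy ↦ by simp [hy]
  have h2 : ContMDiffAt (𝓡 n) 𝓘(ℝ, ℝ) 2 η x :=
    (hη.of_le (WithTop.coe_le_coe.mpr le_top)).contMDiffAt
  have key := weightedLaplacian_affine (g := g) (V := V) h2 1 (-1)
  rw [g.dalembertian_eq_zero_of_eventuallyEq_zero h0,
    PseudoRiemannianMetric.mvfderiv_eq_zero_of_eventuallyEq_zero (I := 𝓡 n) h0] at key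
  simpa [PseudoRiemannianMetric.innerDual] using key.symm

omit [SecondCountableTopology M] [T3Space M] [MeasurableSpace M] [BorelSpace M] in
/-- The weighted Laplacian `Lη` of a smooth compactly supported `η` is continuous with compact
support (it vanishes off `tsupport η`). [folklore] -/
theorem continuous_hasCompactSupport_weightedLaplacian {η V : M → ℝ}
    (hη : ContMDiff (𝓡 n) 𝓘(ℝ, ℝ) ∞ η) (hηc : HasCompactSupport η)
    (hV : ContMDiff (𝓡 n) 𝓘(ℝ, ℝ) ∞ V) :
    Continuous (fun x ↦ g.dalembertian η x - g.innerDual x (mvfderiv (𝓡 n) V x).toLinearMap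
      (mvfderiv (𝓡 n) η x).toLinearMap) ∧
    HasCompactSupport (fun x ↦ g.dalembertian η x - g.innerDual x
      (mvfderiv (𝓡 n) V x).toLinearMap (mvfderiv (𝓡 n) η x).toLinearMap) := by
  refine ⟨(continuous_dalembertian g (hη.of_le (WithTop.coe_le_coe.mpr le_top))).sub
    (continuous_innerDual_mvfderiv g (hV.of_le (by norm_num)) (hη.of_le (by norm_num))),
    HasCompactSupport.intro hηc fun x hx ↦ ?_⟩
  simp [g.dalembertian_eq_zero_of_notMem_tsupport hx, mvfderiv_eq_zero_of_notMem_tsupport hx,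
    PseudoRiemannianMetric.innerDual]

/-! ### The weighted Green identity with one compactly supported factor -/

/-- **Weighted Green identity on a (non-compact) weighted manifold, one factor compactly
supported**: for `a ∈ C¹`, `b ∈ C²`, `V ∈ C¹` with `a` or `b` compactly supported,
`∫ a (Lb) e^{-V} dV_g = −∫ g⁻¹(da, db) e^{-V} dV_g`, `Lb = Δ_g b − g⁻¹(dV, db)` — Green's first
identity for compactly supported functions (`GreenIdentityCompactSupport`) applied to
`u = a e^{-V}`, `f = b`, with `d(a e^{-V}) = e^{-V} da − a e^{-V} dV`; the manifold (modelled on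
`ℝⁿ`, second countable) is locally compact and σ-compact. This is the integration by parts
`∫ f Lg dμ = −∫ Γ(f, g) dμ` of the Markov triple `(M, e^{-V}dV, Γ)` for compactly supported data.
[cite: BakryGentilLedoux2014, §3.2 (weighted Riemannian manifolds as Markov triples: integration by
parts for compactly supported smooth functions)] -/
theorem integral_mul_weightedLaplacian_of_hasCompactSupport (hg : g.IsRiemannian) {a b V : M → ℝ}
    (ha : ContMDiff (𝓡 n) 𝓘(ℝ, ℝ) 1 a) (hb : ContMDiff (𝓡 n) 𝓘(ℝ, ℝ) 2 b)
    (hV : ContMDiff (𝓡 n) 𝓘(ℝ, ℝ) 1 V) (hc : HasCompactSupport a ∨ HasCompactSupport b) :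
    ∫ x, a x * (g.dalembertian b x - g.innerDual x (mvfderiv (𝓡 n) V x).toLinearMap
        (mvfderiv (𝓡 n) b x).toLinearMap) * Real.exp (-V x) ∂g.riemVolume =
      -∫ x, g.innerDual x (mvfderiv (𝓡 n) a x).toLinearMap (mvfderiv (𝓡 n) b x).toLinearMap *
        Real.exp (-V x) ∂g.riemVolume := by
  haveI : LocallyCompactSpace M := Manifold.locallyCompact_of_finiteDimensional (M := M) (𝓡 n)
  haveI : IsFiniteMeasureOnCompacts g.riemVolume :=
    CarrilloNi2009_shrinkerLSI.isFiniteMeasureOnCompacts_riemVolume hg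
  have hexp : ContMDiff (𝓡 n) 𝓘(ℝ, ℝ) 1 (fun y ↦ Real.exp (-V y)) :=
    ((Real.contDiff_exp.comp contDiff_neg).of_le le_top).comp_contMDiff hV
  have hu : ContMDiff (𝓡 n) 𝓘(ℝ, ℝ) 1 (fun y ↦ a y * Real.exp (-V y)) := ha.mul hexp
  have hb1 : ContMDiff (𝓡 n) 𝓘(ℝ, ℝ) 1 b := hb.of_le (by norm_num)
  -- Green's first identity for `u = a e^{-V}`, `f = b`, and a compact set off which things vanish
  obtain ⟨K, hK, hoff, hG⟩ : ∃ K : Set M, IsCompact K ∧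
      (∀ x ∉ K, (a x = 0 ∧ mvfderiv (𝓡 n) a x = 0) ∨
        (g.dalembertian b x = 0 ∧ mvfderiv (𝓡 n) b x = 0)) ∧
      ∫ x, (a x * Real.exp (-V x)) * g.dalembertian b x ∂g.riemVolume =
        -∫ x, g.innerDual x (mvfderiv (𝓡 n) (fun y ↦ a y * Real.exp (-V y)) x).toLinearMap
          (mvfderiv (𝓡 n) b x).toLinearMap ∂g.riemVolume := by
    haveI := (PseudoRiemannianMetric.ofRiemannian (g.toContMDiffRiemannianMetric hg)).hasLeviCivita
    rcases hc with hac | hbc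
    · refine ⟨tsupport a, hac, fun x hx ↦ Or.inl ⟨image_eq_zero_of_notMem_tsupport hx,
        mvfderiv_eq_zero_of_notMem_tsupport hx⟩, ?_⟩
      have h1 := integral_mul_dalembertian_eq_neg_integral_innerDual_of_hasCompactSupport
        (g.toContMDiffRiemannianMetric hg) hu (hac.mul_right) hb
      rw [PseudoRiemannianMetric.riemVolume_eq hg]
      exact h1
    · refine ⟨tsupport b, hbc, fun x hx ↦ Or.inr ⟨g.dalembertian_eq_zero_of_notMem_tsupport hx,
        mvfderiv_eq_zero_of_notMem_tsupport hx⟩, ?_⟩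
      have h1 := integral_mul_dalembertian_eq_neg_integral_innerDual_of_hasCompactSupport_right
        (g.toContMDiffRiemannianMetric hg) hu hb hbc
      rw [PseudoRiemannianMetric.riemVolume_eq hg]
      exact h1
  -- the integrand of the right-hand side of Green, pointwise
  have hpt : ∀ x, g.innerDual x (mvfderiv (𝓡 n) (fun y ↦ a y * Real.exp (-V y)) x).toLinearMap
        (mvfderiv (𝓡 n) b x).toLinearMap =
      g.innerDual x (mvfderiv (𝓡 n) a x).toLinearMap (mvfderiv (𝓡 n) b x).toLinearMap *
          Real.exp (-V x)
        - a x * g.innerDual x (mvfderiv (𝓡 n) V x).toLinearMap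
            (mvfderiv (𝓡 n) b x).toLinearMap * Real.exp (-V x) := by
    intro x
    rw [mvfderiv_mul_exp_neg_toLinearMap (ha.mdifferentiableAt one_ne_zero)
      (hV.mdifferentiableAt one_ne_zero), g.innerDual_sub_left, g.innerDual_smul_left,
      g.innerDual_smul_left]
    ring
  -- continuity, vanishing off `K`, integrability
  have hΔc : Continuous (g.dalembertian b) := continuous_dalembertian g hb
  have hIVc : Continuous fun x ↦ g.innerDual x (mvfderiv (𝓡 n) V x).toLinearMap
      (mvfderiv (𝓡 n) b x).toLinearMap := continuous_innerDual_mvfderiv g hV hb1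
  have hIac : Continuous fun x ↦ g.innerDual x (mvfderiv (𝓡 n) a x).toLinearMap
      (mvfderiv (𝓡 n) b x).toLinearMap := continuous_innerDual_mvfderiv g ha hb1
  have hec : Continuous fun x ↦ Real.exp (-V x) := hexp.continuous
  have i1 : Integrable (fun x ↦ (a x * Real.exp (-V x)) * g.dalembertian b x) g.riemVolume := by
    refine ((ha.continuous.mul hec).mul hΔc).integrable_of_hasCompactSupport
      (HasCompactSupport.intro hK fun x hx ↦ ?_)
    rcases hoff x hx with ⟨h0, -⟩ | ⟨h0, -⟩ <;> simp [h0]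
  have i2 : Integrable (fun x ↦ a x * g.innerDual x (mvfderiv (𝓡 n) V x).toLinearMap
      (mvfderiv (𝓡 n) b x).toLinearMap * Real.exp (-V x)) g.riemVolume := by
    refine ((ha.continuous.mul hIVc).mul hec).integrable_of_hasCompactSupport
      (HasCompactSupport.intro hK fun x hx ↦ ?_)
    rcases hoff x hx with ⟨h0, -⟩ | ⟨-, h0⟩
    · simp [h0]
    · simp [h0, PseudoRiemannianMetric.innerDual]
  have i3 : Integrable (fun x ↦ g.innerDual x (mvfderiv (𝓡 n) a x).toLinearMap
      (mvfderiv (𝓡 n) b x).toLinearMap * Real.exp (-V x)) g.riemVolume := by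
    refine (hIac.mul hec).integrable_of_hasCompactSupport
      (HasCompactSupport.intro hK fun x hx ↦ ?_)
    rcases hoff x hx with ⟨-, h0⟩ | ⟨-, h0⟩ <;> simp [h0, PseudoRiemannianMetric.innerDual]
  -- split the integrals
  have s1 : ∫ x, a x * (g.dalembertian b x - g.innerDual x (mvfderiv (𝓡 n) V x).toLinearMap
        (mvfderiv (𝓡 n) b x).toLinearMap) * Real.exp (-V x) ∂g.riemVolume =
      ∫ x, ((a x * Real.exp (-V x)) * g.dalembertian b x
        - a x * g.innerDual x (mvfderiv (𝓡 n) V x).toLinearMap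
            (mvfderiv (𝓡 n) b x).toLinearMap * Real.exp (-V x)) ∂g.riemVolume :=
    integral_congr_ae (Eventually.of_forall fun x ↦ by ring)
  have s2 := integral_sub i1 i2
  have s3 : ∫ x, g.innerDual x (mvfderiv (𝓡 n) (fun y ↦ a y * Real.exp (-V y)) x).toLinearMap
        (mvfderiv (𝓡 n) b x).toLinearMap ∂g.riemVolume =
      ∫ x, (g.innerDual x (mvfderiv (𝓡 n) a x).toLinearMap (mvfderiv (𝓡 n) b x).toLinearMap *
          Real.exp (-V x)
        - a x * g.innerDual x (mvfderiv (𝓡 n) V x).toLinearMap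
            (mvfderiv (𝓡 n) b x).toLinearMap * Real.exp (-V x)) ∂g.riemVolume :=
    integral_congr_ae (Eventually.of_forall hpt)
  have s4 := integral_sub i3 i2
  linarith [hG, s1, s2, s3, s4]

/-! ### The dissipation inequality of the energy method -/

/-- **Dissipation inequality.** For smooth `w`, `V`, a smooth compactly supported `η ≥ 0` and a
`C^∞` test function `Φ ≥ 0` with `Φ'' ≥ 0`:
`∫ η Φ'(w) (Lw) e^{-V} ≤ ∫ |Lη| Φ(w) e^{-V}`. Indeed, by the weighted Green identity (the factor
`Φ'(w) η` is compactly supported) the left side is `−∫ g⁻¹(d(Φ'(w)η), dw) e^{-V}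
= −∫ Φ''(w) η |dw|² e^{-V} − ∫ Φ'(w) g⁻¹(dη, dw) e^{-V} ≤ −∫ g⁻¹(d(Φ∘w), dη) e^{-V}
= ∫ Φ(w) (Lη) e^{-V}` (Green again, `η` compactly supported), and `Φ(w) Lη ≤ |Lη| Φ(w)`. This is
the integration-by-parts step of the energy method (uniqueness class / maximum principle for the
Cauchy problem of the heat equation on complete weighted manifolds via cut-off functions).
[cite: Grigoryan2009, §11.4 and §12.1 (energy estimates with cut-off functions on complete weighted
manifolds; integrated maximum principle)] -/
theorem integral_test_dissipation_le (hg : g.IsRiemannian) {w η V : M → ℝ}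
    (hw : ContMDiff (𝓡 n) 𝓘(ℝ, ℝ) ∞ w) (hη : ContMDiff (𝓡 n) 𝓘(ℝ, ℝ) ∞ η)
    (hηc : HasCompactSupport η) (hη0 : ∀ x, 0 ≤ η x) (hV : ContMDiff (𝓡 n) 𝓘(ℝ, ℝ) ∞ V)
    {Φ : ℝ → ℝ} (hΦ : ContDiff ℝ ∞ Φ) (hΦ0 : ∀ t, 0 ≤ Φ t) (hΦ'' : ∀ t, 0 ≤ deriv (deriv Φ) t) :
    ∫ x, (η x * Real.exp (-V x)) * (deriv Φ (w x) * (g.dalembertian w x -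
        g.innerDual x (mvfderiv (𝓡 n) V x).toLinearMap (mvfderiv (𝓡 n) w x).toLinearMap))
        ∂g.riemVolume ≤
      ∫ x, (|g.dalembertian η x - g.innerDual x (mvfderiv (𝓡 n) V x).toLinearMap
        (mvfderiv (𝓡 n) η x).toLinearMap| * Real.exp (-V x)) * Φ (w x) ∂g.riemVolume := by
  -- smoothness
  have hΦ' : ContDiff ℝ ∞ (deriv Φ) := (contDiff_infty_iff_deriv.1 hΦ).2
  have hΦd : ∀ t, HasDerivAt Φ (deriv Φ t) t := fun t ↦ (hΦ.differentiable (by simp) t).hasDerivAt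
  have hΦ'd : ∀ t, HasDerivAt (deriv Φ) (deriv (deriv Φ) t) t := fun t ↦
    (hΦ'.differentiable (by simp) t).hasDerivAt
  have ha : ContMDiff (𝓡 n) 𝓘(ℝ, ℝ) ∞ (fun x ↦ deriv Φ (w x) * η x) :=
    (hΦ'.comp_contMDiff hw).mul hη
  have hac : HasCompactSupport (fun x ↦ deriv Φ (w x) * η x) := hηc.mul_left
  have hΦw : ContMDiff (𝓡 n) 𝓘(ℝ, ℝ) ∞ (fun x ↦ Φ (w x)) := hΦ.comp_contMDiff hw
  have hwd : ∀ x, MDifferentiableAt (𝓡 n) 𝓘(ℝ, ℝ) w x := fun x ↦ hw.mdifferentiableAt (by simp)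
  have hηd : ∀ x, MDifferentiableAt (𝓡 n) 𝓘(ℝ, ℝ) η x := fun x ↦ hη.mdifferentiableAt (by simp)
  -- the two Green identities
  have h2le : (2 : ℕ∞ω) ≤ (∞ : ℕ∞ω) := WithTop.coe_le_coe.mpr le_top
  have hG1 := integral_mul_weightedLaplacian_of_hasCompactSupport hg (ha.of_le (by norm_num))
    (hw.of_le h2le) (hV.of_le (by norm_num)) (Or.inl hac)
  have hG2 := integral_mul_weightedLaplacian_of_hasCompactSupport hg (hΦw.of_le (by norm_num))
    (hη.of_le h2le) (hV.of_le (by norm_num)) (Or.inr hηc)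
  -- pointwise: `g⁻¹(d(Φ∘w), dη) ≤ g⁻¹(d(Φ'(w) η), dw)` (the difference is `η Φ''(w) |dw|² ≥ 0`)
  have h1 : ∀ x, (mvfderiv (𝓡 n) (fun y ↦ Φ (w y)) x).toLinearMap =
      deriv Φ (w x) • (mvfderiv (𝓡 n) w x).toLinearMap := fun x ↦ by
    ext v
    exact mvfderiv_real_comp_apply (I := 𝓡 n) (hΦd (w x)) (hwd x) v
  have h2 : ∀ x, (mvfderiv (𝓡 n) (fun y ↦ deriv Φ (w y) * η y) x).toLinearMap =
      deriv Φ (w x) • (mvfderiv (𝓡 n) η x).toLinearMap +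
        (η x * deriv (deriv Φ) (w x)) • (mvfderiv (𝓡 n) w x).toLinearMap := fun x ↦ by
    have hΦ'w : MDifferentiableAt (𝓡 n) 𝓘(ℝ, ℝ) (fun y ↦ deriv Φ (w y)) x :=
      (hΦ'.comp_contMDiff hw).mdifferentiableAt (by simp)
    ext v
    have hmul := mvfderiv_fun_mul hΦ'w (hηd x)
    have hch : mvfderiv (𝓡 n) (fun y ↦ deriv Φ (w y)) x v =
        deriv (deriv Φ) (w x) * mvfderiv (𝓡 n) w x v :=
      mvfderiv_real_comp_apply (I := 𝓡 n) (hΦ'd (w x)) (hwd x) v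
    simp only [ContinuousLinearMap.coe_coe, LinearMap.add_apply, LinearMap.smul_apply, smul_eq_mul]
    rw [hmul]
    simp only [add_apply, FunLike.coe_smul, Pi.smul_apply, smul_eq_mul, hch]
    ring
  have hpt : ∀ x, g.innerDual x (mvfderiv (𝓡 n) (fun y ↦ Φ (w y)) x).toLinearMap
        (mvfderiv (𝓡 n) η x).toLinearMap ≤
      g.innerDual x (mvfderiv (𝓡 n) (fun y ↦ deriv Φ (w y) * η y) x).toLinearMap
        (mvfderiv (𝓡 n) w x).toLinearMap := by
    intro x
    rw [h1, h2, g.innerDual_smul_left, g.innerDual_add_left, g.innerDual_smul_left,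
      g.innerDual_smul_left]
    rw [g.innerDual_comm x (mvfderiv (𝓡 n) η x).toLinearMap (mvfderiv (𝓡 n) w x).toLinearMap]
    have hsq := g.innerDual_self_nonneg hg x (mvfderiv (𝓡 n) w x).toLinearMap
    nlinarith [mul_nonneg (mul_nonneg (hη0 x) (hΦ'' (w x))) hsq]
  -- continuity and compact support of the integrands
  haveI : IsFiniteMeasureOnCompacts g.riemVolume :=
    CarrilloNi2009_shrinkerLSI.isFiniteMeasureOnCompacts_riemVolume hg
  have hec : Continuous fun x ↦ Real.exp (-V x) := Real.continuous_exp.comp hV.continuous.neg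
  obtain ⟨hLηc, hLηs⟩ := continuous_hasCompactSupport_weightedLaplacian (g := g) hη hηc hV
  have hIa : Continuous fun x ↦ g.innerDual x
      (mvfderiv (𝓡 n) (fun y ↦ deriv Φ (w y) * η y) x).toLinearMap
      (mvfderiv (𝓡 n) w x).toLinearMap :=
    continuous_innerDual_mvfderiv g (ha.of_le (by norm_num)) (hw.of_le (by norm_num))
  have hIb : Continuous fun x ↦ g.innerDual x (mvfderiv (𝓡 n) (fun y ↦ Φ (w y)) x).toLinearMap
      (mvfderiv (𝓡 n) η x).toLinearMap :=
    continuous_innerDual_mvfderiv g (hΦw.of_le (by norm_num)) (hη.of_le (by norm_num))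
  have hKa : HasCompactSupport fun x ↦ g.innerDual x
      (mvfderiv (𝓡 n) (fun y ↦ deriv Φ (w y) * η y) x).toLinearMap
      (mvfderiv (𝓡 n) w x).toLinearMap * Real.exp (-V x) := by
    refine HasCompactSupport.intro hac fun x hx ↦ ?_
    simp [mvfderiv_eq_zero_of_notMem_tsupport hx, PseudoRiemannianMetric.innerDual]
  have hKb : HasCompactSupport fun x ↦ g.innerDual x
      (mvfderiv (𝓡 n) (fun y ↦ Φ (w y)) x).toLinearMap
      (mvfderiv (𝓡 n) η x).toLinearMap * Real.exp (-V x) := by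
    refine HasCompactSupport.intro hηc fun x hx ↦ ?_
    simp [mvfderiv_eq_zero_of_notMem_tsupport hx, PseudoRiemannianMetric.innerDual]
  have ia := (hIa.mul hec).integrable_of_hasCompactSupport (μ := g.riemVolume) hKa
  have ib := (hIb.mul hec).integrable_of_hasCompactSupport (μ := g.riemVolume) hKb
  have ic : Integrable (fun x ↦ Φ (w x) * (g.dalembertian η x - g.innerDual x
      (mvfderiv (𝓡 n) V x).toLinearMap (mvfderiv (𝓡 n) η x).toLinearMap) * Real.exp (-V x))
      g.riemVolume :=
    ((hΦw.continuous.mul hLηc).mul hec).integrable_of_hasCompactSupport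
      ((hLηs.mul_left).mul_right)
  have id : Integrable (fun x ↦ (|g.dalembertian η x - g.innerDual x
      (mvfderiv (𝓡 n) V x).toLinearMap (mvfderiv (𝓡 n) η x).toLinearMap| * Real.exp (-V x)) *
      Φ (w x)) g.riemVolume :=
    (((hLηc.abs).mul hec).mul hΦw.continuous).integrable_of_hasCompactSupport
      (((hLηs.comp_left (g := fun t : ℝ ↦ |t|) abs_zero).mul_right).mul_right)
  -- the chain
  calc ∫ x, (η x * Real.exp (-V x)) * (deriv Φ (w x) * (g.dalembertian w x -
          g.innerDual x (mvfderiv (𝓡 n) V x).toLinearMap (mvfderiv (𝓡 n) w x).toLinearMap))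
          ∂g.riemVolume
      = ∫ x, (deriv Φ (w x) * η x) * (g.dalembertian w x -
          g.innerDual x (mvfderiv (𝓡 n) V x).toLinearMap (mvfderiv (𝓡 n) w x).toLinearMap) *
          Real.exp (-V x) ∂g.riemVolume :=
        integral_congr_ae (Eventually.of_forall fun x ↦ by ring)
    _ = -∫ x, g.innerDual x (mvfderiv (𝓡 n) (fun y ↦ deriv Φ (w y) * η y) x).toLinearMap
          (mvfderiv (𝓡 n) w x).toLinearMap * Real.exp (-V x) ∂g.riemVolume := hG1
    _ ≤ -∫ x, g.innerDual x (mvfderiv (𝓡 n) (fun y ↦ Φ (w y)) x).toLinearMap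
          (mvfderiv (𝓡 n) η x).toLinearMap * Real.exp (-V x) ∂g.riemVolume :=
        neg_le_neg (integral_mono ib ia fun x ↦
          mul_le_mul_of_nonneg_right (hpt x) (Real.exp_pos _).le)
    _ = ∫ x, Φ (w x) * (g.dalembertian η x - g.innerDual x
          (mvfderiv (𝓡 n) V x).toLinearMap (mvfderiv (𝓡 n) η x).toLinearMap) * Real.exp (-V x)
          ∂g.riemVolume := hG2.symm
    _ ≤ ∫ x, (|g.dalembertian η x - g.innerDual x (mvfderiv (𝓡 n) V x).toLinearMap
          (mvfderiv (𝓡 n) η x).toLinearMap| * Real.exp (-V x)) * Φ (w x) ∂g.riemVolume := by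
        refine integral_mono ic id fun x ↦ ?_
        have hΦx := hΦ0 (w x)
        have hex := (Real.exp_pos (-V x)).le
        have hle := le_abs_self (g.dalembertian η x - g.innerDual x
          (mvfderiv (𝓡 n) V x).toLinearMap (mvfderiv (𝓡 n) η x).toLinearMap)
        nlinarith [mul_nonneg hΦx hex, mul_le_mul_of_nonneg_left hle (mul_nonneg hΦx hex)]


end Manifold

end Literature.Geometry.Riemannian

end
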